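import Literature.Geometry.Symplectic.SteinDomain
import Literature.Geometry.Kaehler.ManifoldFormsPullback
import Mathlib.Geometry.Manifold.Diffeomorph
import HarnessLib

/-!
# Stein structures are transported by diffeomorphisms

Topic `Literature/Geometry/Symplectic`; fact seat
`provefact-Literature.Geometry.Symplectic.Gompf1998` for Eliashberg's theorem without `2`-handles,
`Literature.Geometry.Symplectic.Gompf1998_thm13_noTwoHandles` (`SteinHandlebodies.lean`).  The
proof of that fact identifies a compact connected orientable `1`-handlebody `W` with a model
`♮ᵏ (S¹ × B³)` by a **diffeomorphism** (the classification facts NORM + UNIQ₄ of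
`SPC4HandlesModelReduction.lean`) and the models are Stein domains
(`SteinOneHandlebodies.lean`); this file supplies the missing link, **invariance of
`IsSteinDomain` (`SteinDomain.lean`) under diffeomorphism**, proved:

* `SteinStructure.comap e S` — the transport of a Stein structure `S` on `M` along a
  diffeomorphism `e : P ≅ M` of compact `4`-manifolds with boundary: `J'_x = (De_x)⁻¹ J_{e x} De_x`
  (`comapJ`), `φ' = φ ∘ e`;
* `IsSteinDomain.of_diffeomorph`, `isSteinDomain_iff_of_diffeomorph`.

Stein structures, like complex structures and `J`-convex functions, pull back under
biholomorphisms by definition (Cieliebak–Eliashberg 2012, Ch. 2; Gompf 1998, §1); the content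
here is that the tree's *rendering* of `SteinStructure` — smoothness of `J` through smooth vector
fields, integrability through Mathlib's manifold Lie bracket, `J`-convexity through the tree's
chart-wise exterior derivative `Literature.Geometry.Kaehler.mextDeriv` — is natural:

* §0 `mextDeriv_pullback_apply_of_differentiableWithinAt`: naturality of `d` at a point
  (`d(f^*β) x = f^*(dβ) x`) for a form which is merely *differentiable* in its chart at `f x` —
  the tree's `Literature.Geometry.Kaehler.mextDeriv_pullback_apply` (Warner, Prop. 2.23) with
  its hypothesis weakened to that of Mathlib's `extDerivWithin_pullback`, same proof;
* §1 `diffeoDeriv e x : ℝ⁴ ≃L ℝ⁴`, the differential of `e` with inverse `D(e⁻¹)`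
  (Mathlib's `OpenPartialHomeomorph.MDifferentiable.mfderiv`); Mathlib's `mpullback` along `e`
  is `(De)⁻¹ ∘ V ∘ e` (`mpullback_diffeo`);
* §2 push-forward `pushVF e X = (e⁻¹)^* X` and pull-back of smooth vector fields are smooth
  (`ContMDiff.mpullback_vectorField`), `e^*(e_* X) = X`, and
  `[X, Y] = (De)⁻¹ [e_* X, e_* Y] ∘ e` (`mlieBracket_eq_pushVF`, Mathlib's
  `VectorField.mpullback_mlieBracket`);
* §3 the transported structure: `J'² = -1`; `J' X = e^*(J (e_* X))` is smooth; the Nijenhuis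
  tensor of `J'` is `(De)⁻¹` of that of `J` on push-forwards, hence zero; `d^ℂ(φ ∘ e) = e^*(d^ℂφ)`
  (`dComplex_comap_eq_pullback`), and — the one subtle point — **strict `J`-convexity of `φ`
  forces differentiability of `d^ℂφ` in its charts** (`SteinStructure.differentiableWithinAt_inChart_dComplex`:
  otherwise Mathlib's `fderivWithin`, hence `mextDeriv (d^ℂφ)`, would vanish), so §0 applies and
  `-dd^ℂ(φ ∘ e)(v, J'v) = -dd^ℂφ (De v, J De v) > 0` (`neg_mextDeriv_dComplex_comap`); boundary
  points correspond under `e` (Mathlib's `IsLocalDiffeomorphAt.isBoundaryPoint_iff`),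
  `sup (φ ∘ e) = sup φ`, and `d(φ ∘ e) = dφ ∘ De ≠ 0` on `∂P`.

## References

* K. Cieliebak, Ya. Eliashberg, *From Stein to Weinstein and back*, AMS Colloquium Publ. 59
  (2012), Ch. 2. [CieliebakEliashberg2012]
* R. E. Gompf, *Handlebody construction of Stein surfaces*, Ann. of Math. 148 (1998), 619–693,
  §1. [Gompf1998]
* F. W. Warner, *Foundations of Differentiable Manifolds and Lie Groups*, GTM 94 (1983),
  Prop. 2.23. [WarnerGTM94]
-/

noncomputable section

open scoped Manifold ContDiff Topology
open Set Function Filter VectorField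

namespace Literature.Geometry.Symplectic

/-- The model vector space `ℝ⁴` of the tangent spaces. [folklore] -/
local notation "E4" => EuclideanSpace ℝ (Fin 4)

/-! ### §0 Naturality of `d` at a point under mere differentiability of the form -/

section Naturality

variable {E : Type*} [NormedAddCommGroup E] [NormedSpace ℝ E] {H : Type*} [TopologicalSpace H]
  {I : ModelWithCorners ℝ E H} {M : Type*} [TopologicalSpace M] [ChartedSpace H M]
  {E' : Type*} [NormedAddCommGroup E'] [NormedSpace ℝ E'] {H' : Type*} [TopologicalSpace H']
  {I' : ModelWithCorners ℝ E' H'} {N : Type*} [TopologicalSpace N] [ChartedSpace H' N]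
  {F : Type*} [NormedAddCommGroup F] [NormedSpace ℝ F] {k : ℕ}
  [IsManifold I ∞ M] [IsManifold I' ∞ N]

/-- **Naturality of `d`, pointwise, for a form which is merely differentiable at the point**
(in its preferred chart): if `f` is `C^∞` near `x` and the representative of `β` in the chart at
`f x` is differentiable within `range I'` at the centre, then `d(f^*β) x = (f^*dβ) x`.  This is
`Literature.Geometry.Kaehler.mextDeriv_pullback_apply` (Warner (1983), Prop. 2.23) with its
smoothness hypothesis on `β` weakened to what Mathlib's `extDerivWithin_pullback` uses; same
proof. [cite: WarnerGTM94, Prop. 2.23] -/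
theorem mextDeriv_pullback_apply_of_differentiableWithinAt {f : M → N} {β : Kaehler.MForm I' N F k}
    {x : M} (hf : ∀ᶠ z in 𝓝 x, ContMDiffAt I I' ∞ f z)
    (hβ : DifferentiableWithinAt ℝ (β.inChart (f x)) (range I') (extChartAt I' (f x) (f x))) :
    Kaehler.mextDeriv (β.pullback I f) x = (Kaehler.mextDeriv β).pullback I f x := by
  have hfx : ContMDiffAt I I' ∞ f x := hf.self_of_nhds
  have hc : extChartAt I x x ∈ range I := mem_range_self _
  have hg : ContDiffWithinAt ℝ ∞ (writtenInExtChartAt I I' x f) (range I) (extChartAt I x x) :=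
    (contMDiffAt_iff.1 hfx).2
  have hev := β.inChart_pullback_eventuallyEq (I := I) (I' := I')
    (hf.mono fun z hz ↦ hz.mdifferentiableAt (by simp))
  have hω : DifferentiableWithinAt ℝ (β.inChart (f x)) (range I')
      (writtenInExtChartAt I I' x f (extChartAt I x x)) := by
    rw [Kaehler.writtenInExtChartAt_apply_self]
    exact hβ
  have hr : minSmoothness ℝ 2 ≤ ∞ := by
    rw [minSmoothness_of_isRCLikeNormedField]
    exact WithTop.coe_le_coe.2 le_top
  rw [Kaehler.mextDeriv_eq_extDerivWithin, hev.extDerivWithin_eq (hev.self_of_nhdsWithin hc),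
    extDerivWithin_pullback hω hg hr I.uniqueDiffOn (I.range_subset_closure_interior hc) hc
      (Kaehler.mapsTo_writtenInExtChartAt_range f x),
    Kaehler.writtenInExtChartAt_apply_self, ← (hfx.mdifferentiableAt (by simp)).mfderiv,
    ← Kaehler.mextDeriv_eq_extDerivWithin]
  rfl

end Naturality

/-! ### §1 The differential of a diffeomorphism as a linear isomorphism of `ℝ⁴` -/

section Diffeo

variable {P M : Type*} [TopologicalSpace P] [ChartedSpace (EuclideanHalfSpace 4) P]
  [TopologicalSpace M] [ChartedSpace (EuclideanHalfSpace 4) M] (e : P ≃ₘ⟮𝓡∂ 4, 𝓡∂ 4⟯ M)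

/-- **The differential `De_x : T_xP → T_{e x}M` of a diffeomorphism** as a linear isomorphism of
`ℝ⁴` (tangent spaces read in the preferred charts), with inverse `D(e⁻¹)_{e x}` (Mathlib's
`OpenPartialHomeomorph.MDifferentiable.mfderiv`). [folklore] -/
def diffeoDeriv (x : P) : E4 ≃L[ℝ] E4 :=
  (e.toOpenPartialHomeomorph_mdifferentiable (by simp)).mfderiv (x := x) (by simp)

/-- `diffeoDeriv` is `mfderiv e`. [folklore] -/
theorem coe_diffeoDeriv (x : P) : (diffeoDeriv e x : E4 →L[ℝ] E4) = mfderiv (𝓡∂ 4) (𝓡∂ 4) e x :=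
  rfl

/-- `diffeoDeriv`, applied. [folklore] -/
theorem diffeoDeriv_apply (x : P) (v : E4) : diffeoDeriv e x v = mfderiv (𝓡∂ 4) (𝓡∂ 4) e x v :=
  rfl

/-- The inverse of `diffeoDeriv` is `mfderiv e.symm (e x)`. [folklore] -/
theorem coe_diffeoDeriv_symm (x : P) :
    ((diffeoDeriv e x).symm : E4 →L[ℝ] E4) = mfderiv (𝓡∂ 4) (𝓡∂ 4) e.symm (e x) :=
  rfl

/-- The differential of a diffeomorphism is invertible. [folklore] -/
theorem isInvertible_mfderiv_diffeo (x : P) : (mfderiv (𝓡∂ 4) (𝓡∂ 4) e x).IsInvertible :=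
  ⟨diffeoDeriv e x, coe_diffeoDeriv e x⟩

/-- `(De_x)⁻¹` as Mathlib's `ContinuousLinearMap.inverse`. [folklore] -/
theorem inverse_mfderiv_diffeo (x : P) :
    (mfderiv (𝓡∂ 4) (𝓡∂ 4) e x).inverse = ((diffeoDeriv e x).symm : E4 →L[ℝ] E4) := by
  have key := ContinuousLinearMap.inverse_equiv (diffeoDeriv e x)
  rw [coe_diffeoDeriv] at key
  exact key

/-- `(D(e⁻¹)_{e x})⁻¹ = De_x` as Mathlib's `ContinuousLinearMap.inverse`. [folklore] -/
theorem inverse_mfderiv_diffeo_symm (x : P) :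
    (mfderiv (𝓡∂ 4) (𝓡∂ 4) e.symm (e x)).inverse = (diffeoDeriv e x : E4 →L[ℝ] E4) := by
  have key := ContinuousLinearMap.inverse_equiv (diffeoDeriv e x).symm
  rw [coe_diffeoDeriv_symm, ContinuousLinearEquiv.symm_symm] at key
  exact key

/-- **Mathlib's pull-back of a vector field along `e`** is `x ↦ (De_x)⁻¹ (V (e x))`. [folklore] -/
theorem mpullback_diffeo (V : (y : M) → TangentSpace (𝓡∂ 4) y) (x : P) :
    mpullback (𝓡∂ 4) (𝓡∂ 4) e V x = (diffeoDeriv e x).symm (V (e x)) := by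
  rw [mpullback_apply, inverse_mfderiv_diffeo]
  rfl

/-! ### §2 Push-forward and pull-back of smooth vector fields; Lie brackets -/

/-- The push-forward `e_* X` of a vector field of `P` (the pull-back along `e⁻¹`). [folklore] -/
def pushVF (X : (x : P) → TangentSpace (𝓡∂ 4) x) : (y : M) → TangentSpace (𝓡∂ 4) y :=
  mpullback (𝓡∂ 4) (𝓡∂ 4) e.symm X

/-- `(e_* X)(e x) = De_x (X x)`. [folklore] -/
theorem pushVF_apply_diffeo (X : (x : P) → TangentSpace (𝓡∂ 4) x) (x : P) :
    pushVF e X (e x) = diffeoDeriv e x (X x) := by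
  show mpullback (𝓡∂ 4) (𝓡∂ 4) e.symm X (e x) = _
  rw [mpullback_apply, inverse_mfderiv_diffeo_symm, e.symm_apply_apply]
  rfl

/-- `e^* (e_* X) = X`. [folklore] -/
theorem mpullback_pushVF (X : (x : P) → TangentSpace (𝓡∂ 4) x) :
    mpullback (𝓡∂ 4) (𝓡∂ 4) e (pushVF e X) = X := by
  funext x
  rw [mpullback_diffeo, pushVF_apply_diffeo, ContinuousLinearEquiv.symm_apply_apply]

variable [IsManifold (𝓡∂ 4) ∞ P] [IsManifold (𝓡∂ 4) ∞ M]

/-- **The push-forward of a smooth vector field is smooth**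
(`ContMDiff.mpullback_vectorField`). [folklore] -/
theorem isSmoothVectorField_pushVF {X : (x : P) → TangentSpace (𝓡∂ 4) x}
    (hX : IsSmoothVectorField P X) : IsSmoothVectorField M (pushVF e X) :=
  ContMDiff.mpullback_vectorField hX e.symm.contMDiff
    (fun y => isInvertible_mfderiv_diffeo e.symm y) le_rfl

/-- **The pull-back of a smooth vector field is smooth** (`ContMDiff.mpullback_vectorField`).
[folklore] -/
theorem isSmoothVectorField_mpullback {V : (y : M) → TangentSpace (𝓡∂ 4) y}
    (hV : IsSmoothVectorField M V) : IsSmoothVectorField P (mpullback (𝓡∂ 4) (𝓡∂ 4) e V) :=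
  ContMDiff.mpullback_vectorField hV e.contMDiff (fun x => isInvertible_mfderiv_diffeo e x) le_rfl

/-- **Naturality of the Lie bracket**: `[X, Y](x) = (De_x)⁻¹ [e_* X, e_* Y](e x)` for smooth
vector fields (Mathlib's `VectorField.mpullback_mlieBracket`). [folklore] -/
theorem mlieBracket_eq_pushVF {X Y : (x : P) → TangentSpace (𝓡∂ 4) x}
    (hX : IsSmoothVectorField P X) (hY : IsSmoothVectorField P Y) (x : P) :
    mlieBracket (𝓡∂ 4) X Y x =
      (diffeoDeriv e x).symm (mlieBracket (𝓡∂ 4) (pushVF e X) (pushVF e Y) (e x)) := by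
  haveI : IsManifold (𝓡∂ 4) (minSmoothness ℝ 2) P := by
    rw [minSmoothness_of_isRCLikeNormedField]; infer_instance
  haveI : IsManifold (𝓡∂ 4) (minSmoothness ℝ 2) M := by
    rw [minSmoothness_of_isRCLikeNormedField]; infer_instance
  have hVX : MDifferentiableAt (𝓡∂ 4) (𝓡∂ 4).tangent
      (fun y : M => (Bundle.TotalSpace.mk' E4 y (pushVF e X y) : TangentBundle (𝓡∂ 4) M)) (e x) :=
    ((isSmoothVectorField_pushVF e hX) (e x)).mdifferentiableAt (by simp)
  have hVY : MDifferentiableAt (𝓡∂ 4) (𝓡∂ 4).tangent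
      (fun y : M => (Bundle.TotalSpace.mk' E4 y (pushVF e Y y) : TangentBundle (𝓡∂ 4) M)) (e x) :=
    ((isSmoothVectorField_pushVF e hY) (e x)).mdifferentiableAt (by simp)
  have key := mpullback_mlieBracket (I := 𝓡∂ 4) (I' := 𝓡∂ 4) (f := e) (V := pushVF e X)
    (W := pushVF e Y) (x₀ := x) (n := ∞) hVX hVY (e.contMDiff x)
    (by rw [minSmoothness_of_isRCLikeNormedField]; exact ENat.LEInfty.out)
  rw [mpullback_pushVF, mpullback_pushVF] at key
  rw [← key, mpullback_diffeo]

/-! ### §3 Transport of a Stein structure along a diffeomorphism -/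

variable [CompactSpace M] (S : SteinStructure M)

/-- **The transported almost complex structure** `J'_x = (De_x)⁻¹ ∘ J_{e x} ∘ De_x`. [folklore] -/
def comapJ (x : P) : E4 →L[ℝ] E4 :=
  ((diffeoDeriv e x).symm : E4 →L[ℝ] E4).comp ((S.J (e x)).comp (diffeoDeriv e x : E4 →L[ℝ] E4))

omit [IsManifold (𝓡∂ 4) ∞ P] in
/-- Unfolding `comapJ`. [folklore] -/
theorem comapJ_apply (x : P) (v : E4) :
    comapJ e S x v = (diffeoDeriv e x).symm (S.J (e x) (diffeoDeriv e x v)) := rfl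

omit [IsManifold (𝓡∂ 4) ∞ P] in
/-- `De_x (J'_x v) = J_{e x} (De_x v)`. [folklore] -/
@[simp] theorem diffeoDeriv_comapJ (x : P) (v : E4) :
    diffeoDeriv e x (comapJ e S x v) = S.J (e x) (diffeoDeriv e x v) := by
  rw [comapJ_apply, ContinuousLinearEquiv.apply_symm_apply]

omit [IsManifold (𝓡∂ 4) ∞ P] in
/-- `J'_x ((De_x)⁻¹ u) = (De_x)⁻¹ (J_{e x} u)`. [folklore] -/
theorem comapJ_symm_apply (x : P) (u : E4) :
    comapJ e S x ((diffeoDeriv e x).symm u) = (diffeoDeriv e x).symm (S.J (e x) u) := by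
  rw [comapJ_apply, ContinuousLinearEquiv.apply_symm_apply]

omit [IsManifold (𝓡∂ 4) ∞ P] in
/-- `J'² = -1`. [folklore] -/
theorem comapJ_sq (x : P) (v : E4) : comapJ e S x (comapJ e S x v) = -v := by
  apply (diffeoDeriv e x).injective
  rw [diffeoDeriv_comapJ, diffeoDeriv_comapJ, S.J_sq, map_neg]

/-- **`J'` is smooth**: `J' X = e^* (J (e_* X))`. [folklore] -/
theorem isSmoothVectorField_comapJ (X : (x : P) → TangentSpace (𝓡∂ 4) x)
    (hX : IsSmoothVectorField P X) : IsSmoothVectorField P fun x => comapJ e S x (X x) := by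
  have h2 : IsSmoothVectorField M fun y => S.J y (pushVF e X y) :=
    S.J_smooth _ (isSmoothVectorField_pushVF e hX)
  have h3 := isSmoothVectorField_mpullback e h2
  have heq : (fun x => comapJ e S x (X x)) =
      mpullback (𝓡∂ 4) (𝓡∂ 4) e (fun y => S.J y (pushVF e X y)) := by
    funext x
    rw [mpullback_diffeo, pushVF_apply_diffeo]
    rfl
  rw [heq]
  exact h3

omit [IsManifold (𝓡∂ 4) ∞ P] in
/-- `e_* (J' X) = J (e_* X)`. [folklore] -/
theorem pushVF_comapJ (X : (x : P) → TangentSpace (𝓡∂ 4) x) :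
    pushVF e (fun x => comapJ e S x (X x)) = fun y => S.J y (pushVF e X y) := by
  funext y
  obtain ⟨x, rfl⟩ : ∃ x, e x = y := ⟨e.symm y, e.apply_symm_apply y⟩
  rw [pushVF_apply_diffeo, pushVF_apply_diffeo, diffeoDeriv_comapJ]

/-- **`J'` is integrable**: its Nijenhuis tensor is `(De)⁻¹` of that of `J` on the push-forwards,
which vanishes. [folklore] -/
theorem nijenhuis_comapJ_eq_zero {X Y : (x : P) → TangentSpace (𝓡∂ 4) x}
    (hX : IsSmoothVectorField P X) (hY : IsSmoothVectorField P Y) (x : P) :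
    nijenhuis P (comapJ e S) X Y x = 0 := by
  have hJX := isSmoothVectorField_comapJ e S X hX
  have hJY := isSmoothVectorField_comapJ e S Y hY
  have hS := S.integrable (pushVF e X) (pushVF e Y) (isSmoothVectorField_pushVF e hX)
    (isSmoothVectorField_pushVF e hY) (e x)
  simp only [nijenhuis] at hS ⊢
  rw [mlieBracket_eq_pushVF e hJX hJY, mlieBracket_eq_pushVF e hJX hY,
    mlieBracket_eq_pushVF e hX hJY, mlieBracket_eq_pushVF e hX hY, pushVF_comapJ, pushVF_comapJ,
    comapJ_symm_apply, comapJ_symm_apply, ← map_sub, ← map_sub, ← map_sub, hS]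
  exact (diffeoDeriv e x).symm.map_zero

/-! #### The transported function `φ' = φ ∘ e` and its Levi form -/

omit [IsManifold (𝓡∂ 4) ∞ P] in
/-- `φ ∘ e` is smooth. [folklore] -/
theorem contMDiff_phi_comp : ContMDiff (𝓡∂ 4) 𝓘(ℝ, ℝ) ∞ (S.φ ∘ e) :=
  S.φ_smooth.comp e.contMDiff

omit [IsManifold (𝓡∂ 4) ∞ P] in
/-- **The differential of `φ ∘ e`**: `d(φ ∘ e)_x = dφ_{e x} ∘ De_x`. [folklore] -/
theorem mfderiv_phi_comp_apply (x : P) (v : E4) :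
    mfderiv (𝓡∂ 4) 𝓘(ℝ, ℝ) (S.φ ∘ e) x v = mfderiv (𝓡∂ 4) 𝓘(ℝ, ℝ) S.φ (e x) (diffeoDeriv e x v) := by
  rw [mfderiv_comp x ((S.φ_smooth (e x)).mdifferentiableAt (by simp))
    ((e.contMDiff x).mdifferentiableAt (by simp))]
  rfl

omit [IsManifold (𝓡∂ 4) ∞ P] in
/-- **`d^ℂ(φ ∘ e) = e^* (d^ℂ φ)`** for the transported `J'`. [folklore] -/
theorem dComplex_comap_eq_pullback :
    dComplex (comapJ e S) (S.φ ∘ e) =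
      Kaehler.MForm.pullback (I' := 𝓡∂ 4) (𝓡∂ 4) e (dComplex S.J S.φ) := by
  funext x
  ext v
  rw [dComplex_apply, Kaehler.MForm.pullback_apply, dComplex_apply, mfderiv_phi_comp_apply,
    diffeoDeriv_comapJ]
  rfl

/-- **A `J`-convex form is differentiable in its chart**: the representative of `d^ℂφ` in the
preferred chart at `y` is differentiable within the half-space at the centre — otherwise
Mathlib's `fderivWithin`, hence the tree's `mextDeriv (d^ℂφ) y`, would vanish, contradicting
strict `J`-convexity at `y`. [folklore] -/
theorem SteinStructure.differentiableWithinAt_inChart_dComplex (y : M) :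
    DifferentiableWithinAt ℝ ((dComplex S.J S.φ).inChart y) (range (𝓡∂ 4))
      (extChartAt (𝓡∂ 4) y y) := by
  by_contra hnd
  have h0 : Kaehler.mextDeriv (dComplex S.J S.φ) y = 0 := by
    rw [Kaehler.mextDeriv_eq_extDerivWithin, extDerivWithin,
      fderivWithin_zero_of_not_differentiableWithinAt hnd,
      ContinuousAlternatingMap.alternatizeUncurryFin]
    exact map_zero _
  have hv : (EuclideanSpace.single (0 : Fin 4) (1 : ℝ) : E4) ≠ 0 := by
    intro h
    have := congrArg (fun v : E4 => v 0) h
    simp at this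
  have := S.convex y _ hv
  rw [h0] at this
  simp at this

/-- **The Levi form of the transported structure is the Levi form of `S` on `De`-images**:
`-dd^ℂ(φ ∘ e)_x (v, J'_x v) = -dd^ℂφ_{e x} (De_x v, J_{e x} (De_x v))`. [folklore] -/
theorem neg_mextDeriv_dComplex_comap (x : P) (v : E4) :
    -(Kaehler.mextDeriv (dComplex (comapJ e S) (S.φ ∘ e)) x ![v, comapJ e S x v]) =
      -(Kaehler.mextDeriv (dComplex S.J S.φ) (e x)
        ![diffeoDeriv e x v, S.J (e x) (diffeoDeriv e x v)]) := by
  have hf : ∀ᶠ z in 𝓝 x, ContMDiffAt (𝓡∂ 4) (𝓡∂ 4) ∞ e z :=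
    Eventually.of_forall fun z => e.contMDiff z
  have hv : (fun i => mfderiv (𝓡∂ 4) (𝓡∂ 4) e x (![v, comapJ e S x v] i)) =
      ![diffeoDeriv e x v, S.J (e x) (diffeoDeriv e x v)] := by
    funext i
    fin_cases i
    · rfl
    · show mfderiv (𝓡∂ 4) (𝓡∂ 4) e x (comapJ e S x v) = S.J (e x) (diffeoDeriv e x v)
      exact diffeoDeriv_comapJ e S x v
  rw [dComplex_comap_eq_pullback,
    mextDeriv_pullback_apply_of_differentiableWithinAt hf
      (S.differentiableWithinAt_inChart_dComplex (e x)),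
    Kaehler.MForm.pullback_apply]
  exact congrArg (fun w : Fin 2 → E4 => -(Kaehler.mextDeriv (dComplex S.J S.φ) (e x) w)) hv

/-! #### The Stein structure `e^* S` -/

/-- **Transport of a Stein structure along a diffeomorphism** `e : P ≅ M`: the pulled-back
complex structure `J'_x = (De_x)⁻¹ ∘ J_{e x} ∘ De_x` and the function `φ ∘ e`.  `J'² = -1`;
`J'` is smooth and integrable (naturality of pull-backs and Lie brackets of vector fields,
Mathlib's `ContMDiff.mpullback_vectorField`, `VectorField.mpullback_mlieBracket`); `φ ∘ e` is
smooth and strictly `J'`-convex (naturality of `d`, `-dd^ℂ(φ ∘ e)(v, J'v) = -dd^ℂφ(De v, J De v)`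
with `De v ≠ 0`); diffeomorphisms preserve boundary points
(`IsLocalDiffeomorphAt.isBoundaryPoint_iff`), `sup (φ ∘ e) = sup φ`, and
`d(φ ∘ e) = dφ ∘ De ≠ 0` on the boundary.  (Stein structures, like complex structures and
plurisubharmonic functions, pull back under biholomorphisms by definition; here the complex
structure is *defined* as the pull-back, Cieliebak–Eliashberg 2012, Ch. 2.)
[folklore] -/
def SteinStructure.comap [CompactSpace P] : SteinStructure P where
  J := comapJ e S
  φ := S.φ ∘ e
  J_sq := comapJ_sq e S
  J_smooth := isSmoothVectorField_comapJ e S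
  integrable _ _ hX hY x := nijenhuis_comapJ_eq_zero e S hX hY x
  φ_smooth := contMDiff_phi_comp e S
  convex x v hv := by
    rw [neg_mextDeriv_dComplex_comap]
    exact S.convex (e x) _ fun h0 => hv ((diffeoDeriv e x).map_eq_zero_iff.1 h0)
  boundary_eq x := by
    rw [(e.isLocalDiffeomorph x).isBoundaryPoint_iff (by simp), S.boundary_eq (e x), comp_apply,
      EquivLike.range_comp S.φ e]
  regular x hx := by
    have hx' : (𝓡∂ 4).IsBoundaryPoint (e x) :=
      ((e.isLocalDiffeomorph x).isBoundaryPoint_iff (by simp)).1 hx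
    intro h0
    apply S.regular (e x) hx'
    ext u
    have h1 := mfderiv_phi_comp_apply e S x ((diffeoDeriv e x).symm u)
    rw [h0, ContinuousLinearEquiv.apply_symm_apply] at h1
    exact h1.symm

/-- The `J` of the transported structure (definitional). [folklore] -/
@[simp] theorem SteinStructure.comap_J [CompactSpace P] : (S.comap e).J = comapJ e S := rfl

/-- The `φ` of the transported structure is `φ ∘ e` (definitional). [folklore] -/
@[simp] theorem SteinStructure.comap_φ [CompactSpace P] : (S.comap e).φ = S.φ ∘ e := rfl

end Diffeo

section IsSteinDomain

variable {P M : Type*} [TopologicalSpace P] [ChartedSpace (EuclideanHalfSpace 4) P]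
  [IsManifold (𝓡∂ 4) ∞ P] [CompactSpace P] [TopologicalSpace M]
  [ChartedSpace (EuclideanHalfSpace 4) M] [IsManifold (𝓡∂ 4) ∞ M] [CompactSpace M]

/-- **Stein domains are invariant under diffeomorphism**: if `P ≅ M` and `M` is a Stein domain,
so is `P`. [folklore] -/
theorem IsSteinDomain.of_diffeomorph (e : P ≃ₘ⟮𝓡∂ 4, 𝓡∂ 4⟯ M) (h : IsSteinDomain M) :
    IsSteinDomain P := by
  obtain ⟨S⟩ := h
  exact ⟨S.comap e⟩

/-- Diffeomorphic compact `4`-manifolds with boundary are Stein domains simultaneously.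
[folklore] -/
theorem isSteinDomain_iff_of_diffeomorph (e : P ≃ₘ⟮𝓡∂ 4, 𝓡∂ 4⟯ M) :
    IsSteinDomain P ↔ IsSteinDomain M :=
  ⟨IsSteinDomain.of_diffeomorph e.symm, IsSteinDomain.of_diffeomorph e⟩

end IsSteinDomain

end Literature.Geometry.Symplectic
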